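import Summits.CriticalPhenomena.PercolationContinuityZ3.Theorems.Transplant.FKConnectivityAllQForestSeparatorExchange
import HarnessLib

/-!
# Path edge sets in forest configurations

builds on p205010 (kernel theorem, internal audit signed; external expert review pending).  No definitions, no named facts, no sorries;
standard axioms.

Toolkit for the reduction of the level-one sign fact to quotient monotonicity (memo bschramm/FROM-fk-1-g20-SEPARATOR-EXCHANGE.md §3d):
the edge set `π` of a `p–q` path inside a forest configuration `B` — existence, uniqueness (`IsAcyclic.path_unique`), transfer to any
configuration containing `π`, its vertices are `B`-joined to `p`, they are pairwise separated in `B ∖ π`, a vertex off `π` is not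
`π`-joined to `p`, and gluing `π` back onto a configuration that separates the vertices of `π` (plus a further point) gives a forest
in which that point stays off the `p`-cluster (`isForestCfg_union_exchange`, `reachable_sup_of_trace`).
[cite: Grimmett2006, §4.2 Lemma (4.13); §3.8 (pp. 61–62)] [folklore]
-/

noncomputable section

namespace Summit.CriticalPhenomena.PercolationContinuityZ3.Theorems

namespace FK

open Set SimpleGraph Literature.Probability.LatticeModels Literature.Probability.Percolation
open scoped Classical

variable {V : Type*} [Fintype V]

section PathEdges

variable {B B' : BondConfig V} {p q : V} {π π' : Set (Sym2 V)}

omit [Fintype V] in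
/-- A `p–q` join in `⟨B⟩` has a path whose edge set we can name. [folklore] -/
theorem exists_pathEdges (h : (openGraph B).Reachable p q) :
    ∃ π : Set (Sym2 V), ∃ w : (openGraph B).Walk p q, w.IsPath ∧ π = {e | e ∈ w.edges} := by
  obtain ⟨w⟩ := h
  exact ⟨{e | e ∈ w.toPath.1.edges}, w.toPath.1, w.toPath.2, rfl⟩

omit [Fintype V] in
/-- In a forest the edge set of a `p–q` path is unique. [folklore] -/
theorem pathEdges_unique (hB : IsForestCfg B)
    (h : ∃ w : (openGraph B).Walk p q, w.IsPath ∧ π = {e | e ∈ w.edges})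
    (h' : ∃ w : (openGraph B).Walk p q, w.IsPath ∧ π' = {e | e ∈ w.edges}) : π = π' := by
  obtain ⟨w, hw, rfl⟩ := h
  obtain ⟨w', hw', rfl⟩ := h'
  have hP : (⟨w, hw⟩ : (openGraph B).Path p q) = ⟨w', hw'⟩ := hB.2.path_unique _ _
  have hww : w = w' := congrArg Subtype.val hP
  subst hww
  rfl

omit [Fintype V] in
/-- A path edge set lies in the configuration. [folklore] -/
theorem pathEdges_subset (h : ∃ w : (openGraph B).Walk p q, w.IsPath ∧ π = {e | e ∈ w.edges}) : π ⊆ B := by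
  obtain ⟨w, -, rfl⟩ := h
  intro e he
  have h1 : e ∈ (openGraph B).edgeSet := w.edges_subset_edgeSet he
  simp only [openGraph, edgeSet_fromEdgeSet] at h1
  exact h1.1

omit [Fintype V] in
/-- A path edge set of `B` is a path edge set of every configuration containing it. [folklore] -/
theorem pathEdges_transfer (h : ∃ w : (openGraph B).Walk p q, w.IsPath ∧ π = {e | e ∈ w.edges}) (hπ : π ⊆ B') :
    ∃ w : (openGraph B').Walk p q, w.IsPath ∧ π = {e | e ∈ w.edges} := by
  obtain ⟨w, hw, rfl⟩ := h
  have he : ∀ e ∈ w.edges, e ∈ (openGraph B').edgeSet := by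
    intro e he
    have h1 : e ∈ (openGraph B).edgeSet := w.edges_subset_edgeSet he
    simp only [openGraph, edgeSet_fromEdgeSet] at h1 ⊢
    exact ⟨hπ he, h1.2⟩
  exact ⟨w.transfer (openGraph B') he, hw.transfer he, by rw [Walk.edges_transfer]⟩

omit [Fintype V] in
/-- Hence `p ~ q` in every configuration containing a `p–q` path edge set. [folklore] -/
theorem reachable_of_pathEdges_subset (h : ∃ w : (openGraph B).Walk p q, w.IsPath ∧ π = {e | e ∈ w.edges}) (hπ : π ⊆ B') :
    (openGraph B').Reachable p q := by
  obtain ⟨w, -, -⟩ := pathEdges_transfer h hπ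
  exact ⟨w⟩

omit [Fintype V] in
/-- Every vertex of the path is joined to `p`. [folklore] -/
theorem reachable_of_mem_pathEdges (h : ∃ w : (openGraph B).Walk p q, w.IsPath ∧ π = {e | e ∈ w.edges})
    {t : V} (ht : ∃ e ∈ π, t ∈ e) : (openGraph B).Reachable p t := by
  obtain ⟨w, -, rfl⟩ := h
  obtain ⟨e, he, hte⟩ := ht
  have hsup : t ∈ w.support := by
    induction e using Sym2.ind with
    | h a b =>
      rcases Sym2.mem_iff.1 hte with rfl | rfl
      · exact w.fst_mem_support_of_mem_edges he
      · exact w.snd_mem_support_of_mem_edges he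
  exact ⟨w.takeUntil t hsup⟩

omit [Fintype V] in
/-- A sub-walk of the path between two of its vertices, with edges among the path's edges. [folklore] -/
theorem exists_subwalk_of_mem_support {G : SimpleGraph V} {a b : V} (w : G.Walk a b) {t t' : V}
    (ht : t ∈ w.support) (ht' : t' ∈ w.support) : ∃ s : G.Walk t t', ∀ e ∈ s.edges, e ∈ w.edges := by
  obtain ⟨w₁, w₂, rfl⟩ := (w.mem_support_iff_exists_append).1 ht
  rw [Walk.mem_support_append_iff] at ht'
  rcases ht' with h₁ | h₂
  · refine ⟨(w₁.dropUntil t' h₁).reverse, fun e he => ?_⟩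
    rw [Walk.edges_reverse, List.mem_reverse] at he
    rw [Walk.edges_append]
    exact List.mem_append_left _ (w₁.edges_dropUntil_subset_edges h₁ he)
  · refine ⟨w₂.takeUntil t' h₂, fun e he => ?_⟩
    rw [Walk.edges_append]
    exact List.mem_append_right _ (w₂.edges_takeUntil_subset_edges h₂ he)

omit [Fintype V] in
/-- **The vertices of a `p–q` path are pairwise separated in `B ∖ π`** (a second join would give two distinct paths in the forest).
[folklore] -/
theorem eq_of_reachable_diff_pathEdges (hB : IsForestCfg B)
    (h : ∃ w : (openGraph B).Walk p q, w.IsPath ∧ π = {e | e ∈ w.edges})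
    {t t' : V} (ht : ∃ e ∈ π, t ∈ e) (ht' : ∃ e ∈ π, t' ∈ e) (hr : (openGraph (B \ π)).Reachable t t') : t = t' := by
  obtain ⟨w, hw, rfl⟩ := h
  by_contra hne
  -- a path in `B ∖ π`
  obtain ⟨r⟩ := hr
  have hre : ∀ e ∈ r.toPath.1.edges, e ∈ (openGraph B).edgeSet ∧ e ∉ {e | e ∈ w.edges} := by
    intro e he
    have h1 : e ∈ (openGraph (B \ {e | e ∈ w.edges})).edgeSet := r.toPath.1.edges_subset_edgeSet he
    simp only [openGraph, edgeSet_fromEdgeSet, mem_sdiff] at h1 ⊢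
    exact ⟨⟨h1.1.1, h1.2⟩, h1.1.2⟩
  set r' : (openGraph B).Walk t t' := r.toPath.1.transfer (openGraph B) (fun e he => (hre e he).1) with hr'
  have hr'p : r'.IsPath := r.toPath.2.transfer _
  -- a path inside `π`
  have hsup : ∀ {x : V}, (∃ e ∈ {e | e ∈ w.edges}, x ∈ e) → x ∈ w.support := by
    rintro x ⟨e, he, hxe⟩
    induction e using Sym2.ind with
    | h a b =>
      rcases Sym2.mem_iff.1 hxe with rfl | rfl
      · exact w.fst_mem_support_of_mem_edges he
      · exact w.snd_mem_support_of_mem_edges he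
  obtain ⟨s, hs⟩ := exists_subwalk_of_mem_support w (hsup ht) (hsup ht')
  have hsp : s.toPath.1.IsPath := s.toPath.2
  have huniq : (⟨r', hr'p⟩ : (openGraph B).Path t t') = ⟨s.toPath.1, hsp⟩ := hB.2.path_unique _ _
  have hrs : r' = s.toPath.1 := congrArg Subtype.val huniq
  -- `r'` has an edge; it lies in `π` and outside `π`
  have hlen : r'.length ≠ 0 := fun h0 => hne (Walk.eq_of_length_eq_zero h0)
  obtain ⟨e, he⟩ : ∃ e, e ∈ r'.edges := by
    have : r'.edges ≠ [] := by
      intro hnil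
      apply hlen
      rw [← Walk.length_edges, hnil, List.length_nil]
    exact List.exists_mem_of_ne_nil _ this
  have he1 : e ∈ r.toPath.1.edges := by rwa [hr', Walk.edges_transfer] at he
  have he2 : e ∈ w.edges := by
    rw [hrs] at he
    exact hs e (Walk.edges_toPath_subset_edges s he)
  exact (hre e he1).2 he2

omit [Fintype V] in
/-- A vertex not on `π` (and different from `p`) is not `π`-joined to `p`. [folklore] -/
theorem not_reachable_fromEdgeSet_of_not_mem {o p : V} (ho : ∀ e ∈ π, o ∉ e) (hop : o ≠ p) :
    ¬ (fromEdgeSet π).Reachable o p := by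
  rintro ⟨w⟩
  cases w with
  | nil => exact hop rfl
  | cons hadj _ =>
    rw [fromEdgeSet_adj] at hadj
    exact ho _ hadj.1 (Sym2.mem_mk_left _ _)

/-- **Gluing the path back.**  If `π` is a forest whose pairs lie on `X`, `Z` is a forest configuration disjoint from `π` in which the
points of `X` are pairwise separated, then `π ∪ Z` is a forest (`isForestCfg_union_exchange` with the empty configuration in place of
`Z`). [cite: Grimmett2006, §4.2 Lemma (4.13)] -/
theorem isForestCfg_union_of_separated {Z : BondConfig V} {X : Set V} (hπX : ∀ e ∈ π, ∀ x ∈ e, x ∈ X)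
    (hsep : ∀ x ∈ X, ∀ x' ∈ X, (openGraph Z).Reachable x x' → x = x') (hd : Disjoint π Z)
    (hπ : IsForestCfg π) (hZ : IsForestCfg Z) : IsForestCfg (π ∪ Z) := by
  refine isForestCfg_union_exchange (U := π) (Z := (∅ : BondConfig V)) (Z' := Z) (W := X) (X := X) hπX
    (fun e he => absurd he (Set.notMem_empty e)) (fun e _ x _ hx => hx) (fun x hx x' hx' => ?_)
    (Set.disjoint_empty π) hd (by rwa [Set.union_empty]) hZ
  constructor
  · intro h
    have hbot : openGraph (∅ : BondConfig V) = ⊥ := by simp [openGraph]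
    rw [hbot, reachable_bot] at h
    subst h
    rfl
  · intro h
    rw [hsep x hx x' hx' h]

omit [Fintype V] in
/-- **… and the extra point stays off the `p`-cluster**: if the pairs of `π` lie on `X`, the points of `X` are pairwise separated in `Z`,
`o, p ∈ X`, `o ≠ p` and `o` is on no pair of `π`, then `o ≁ p` in `⟨π ∪ Z⟩` (`reachable_sup_of_trace`: an excursion through `Z` returns
to the point of `X` it left). [cite: Grimmett2006, §4.2 Lemma (4.13)] -/
theorem not_reachable_union_of_separated {Z : BondConfig V} {X : Set V} {o p : V} (hπX : ∀ e ∈ π, ∀ x ∈ e, x ∈ X)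
    (hsep : ∀ x ∈ X, ∀ x' ∈ X, (openGraph Z).Reachable x x' → x = x') (ho : o ∈ X) (hp : p ∈ X) (hop : o ≠ p)
    (hoπ : ∀ e ∈ π, o ∉ e) : ¬ (openGraph (π ∪ Z)).Reachable o p := by
  intro h
  have h' : (fromEdgeSet π ⊔ fromEdgeSet Z).Reachable o p := by
    simpa only [openGraph, fromEdgeSet_union] using h
  have key := reachable_sup_of_trace (a := π) (ξ := Z) (ξ' := (∅ : Set (Sym2 V))) (W := X) (X := X) hπX
    (fun e _ x _ hx => hx) (fun x hx x' hx' hxx' => by rw [hsep x hx x' hx' hxx']) ho hp h'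
  rw [fromEdgeSet_empty, sup_bot_eq] at key
  exact not_reachable_fromEdgeSet_of_not_mem hoπ hop key

end PathEdges

end FK

end Summit.CriticalPhenomena.PercolationContinuityZ3.Theorems
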